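import Literature.NumberTheory.EllipticCurves.Kato2004.AdmissibleZetaClassRealisability
import Literature.NumberTheory.EllipticCurves.Kato2004.IwasawaCohomologyEulerSystemLift
import Literature.NumberTheory.EllipticCurves.Kato2004.MemberMultiplierInputs
import Literature.NumberTheory.EllipticCurves.Kato2004.LocPKummerLog
import Literature.NumberTheory.EllipticCurves.LeadingTerm
import Literature.NumberTheory.EllipticCurves.Rank1Residual.Typed.Basic
import Literature.NumberTheory.EllipticCurves.CongruenceNumber
import Literature.NumberTheory.EllipticCurves.HeegnerPoints
import Literature.NumberTheory.EllipticCurves.ImaginaryPeriod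
import Literature.NumberTheory.EllipticCurves.BDPAnticyclotomicPAdicLFunction
import Literature.NumberTheory.EllipticCurves.Castella2018.PAdicWaldspurgerFormula
import Literature.FieldTheory.AlgClosed.PadicAlgClEquivComplex
import Literature.NumberTheory.EllipticCurves.KrausOesterle1992.TorsionCongruenceCriterionHasseWeilProofs
import Summits.BirchSwinnertonDyer.Rank1Residual.X11b.EmbeddingDatumPrime
import Summits.BirchSwinnertonDyer.Rank1Residual.Partition.Rows
import HarnessLib

/-!
# The BDV-calibration split of `A♭-fam` — Defs (crux stmt-BirchSwinnertonDyer-19715, (α2) item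
# stmt-BirchSwinnertonDyer-33169 `ErratumRoadFive.KatoValuationIneqNonsplitAtFive`; deliverable 1 of idea-9 g48, PORTED)

This is the BUILT port (LEAD `bsd-line-er5-p1` g18, SUMMON key `d1land`, pen g51 / director-bsd (603) step (3)) of the
crux WORKFILE `Cruxes/EulerHalfNotRamNoInertSetAtFive/Lines/bdv_calibration_split.lean` (ideator `bsd-idea-9` g48,
commit 32d3c462f2f9, sha256 `d7c111836b2083c2…`; critic idea-crit-14 V359 PASS, referee g87 PRE-VERIFY PASS), split into
three modules by the tree's 400-line cap: THIS file (§0–§2 vocabulary + `AFlatFamStatement`),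
`ErratumRoadFiveBdvCalibrationSplitCalibratorDefs` (§3, the finer split of the calibrator atom) and
`ErratumRoadFiveBdvCalibrationSplit` (the PROVED recomposition and certificates).  The decl texts are the workfile's
1:1 (same names, same binder order); the only changes are the namespace, `@[conjecture]` on the four CLOSED open
`Prop` constants and on the two open predicates S2/S2a (cell RULING 75: OPEN, nothing asserted) and the pruned imports (no route file is imported, so the
planner may state these constants BY NAME from `Theses/ErratumRoadFive.lean`).  Row table of `bdvExplicitExponent`,
named obligations R1′/F1′/O1/c1–c6 and the «why S1 is not a costume» paragraph: workfile docstring l.33–138 and card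
`Cruxes/EulerHalfNotRamNoInertSetAtFive/Lines/bdv_calibration_split.md` rev 1.1; census
`Lines/bdv22_sec4_constant_ledger.md`; memo `Lines/bdv22_R1_pnew_period.md` rev 1.3.

## What is typed here

The registered open stub `BstwDoor.stub_katoBdpCrossingNonsplitFamily` of
`Cruxes/KatoValuationIneqNonsplitAtFive/Lines/bstw_door.lean` (sha16 `5666110a8ff7d20b`, l.781–833; = `A♭-fam`) is
split into

* `BdvChainExplicitNonsplit` (S1) — **BDV22 (38) valued, up to its `(K,p)`-constant**: ONE function `V : ℕ → ℤ → ℤ` of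
  `(p, d_L)` alone such that for every `p`-non-exceptional rank-one curve (`NonExceptionalRankOneAt`), every
  admissible imaginary quadratic `L` and every value-pinned data tuple of the registered frame, the crossing norm
  identity holds with exponent `bdvExplicitExponent … − V p d_L` [BDV22, §4 (38) p. 44 L13–15 «depend on (K, p) but
  not on f»; Lemma 4.6, (41)–(43), p. 44–45];
* `EisensteinPeriodRatioValuation L p` (S2, the R2 atom) — **a calibrator exists at `(L, p)`**: a good-ordinary
  rank-one big-image curve `E′`, Heegner for `L`, with a full value-pinned data tuple and `σ′ ≠ 0`, on which the
  identity holds with exponent `bdvExplicitExponent …` EXACTLY [BSTW24, Thm. 1.13, §6.2.1 (86)–(94), p. 60];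

and `AFlatFamStatement` is the registered stub statement as a named `Prop` (l.782–832 there, verbatim).  The glue
`S1 → (∀ admissible (L,p), S2) → A♭-fam` is proved in `ErratumRoadFiveBdvCalibrationSplit`.

`bdvExplicitExponent p a_p c s k r_f m_f v_Kato = 1 − ord_p(p + 1 − a_p) + ord_p c − ord_p s − ord_p k − (ord_p r_f − ord_p m_f) − v_Kato`;
at a non-split multiplicative `p ≥ 5`, `a_p = −1` [KO92, Lemme 1] kills the `a_p`-term (`bdvExplicitExponent_of_not_split`).

Sources: [BDV22] Bertolini–Darmon–Venerucci, Adv. Math. 398 (2022) 108172, §4 (38), Lemma 4.6, Thm 3.1.  [BSTW24]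
Burungale–Skinner–Tian–Wan, arXiv:2409.01350, Thm 1.13, Thm 6.4, §6.2.1 (86)–(94), Prop. 4.13.  [Kato04] Astérisque
295, Thm 12.5.  [BDP13] Duke 162, Thm 5.13.  [Castella18] Math. Ann. 370, Thm 2.11/3.2.  [ARS12] Agashe–Ribet–Stein,
Thm 2.1.  [KO92] Kraus–Oesterlé, Lemme 1 p. 262.  Typed ≠ proved; no summit statement is touched; BSD is proved for
no curve.
-/

set_option autoImplicit false
-- D-0017: single-problem summit, so `Summit.BirchSwinnertonDyer.BirchSwinnertonDyer.…` repeats a namespace BY DESIGN.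
set_option linter.dupNamespace false

noncomputable section

open scoped Classical NumberField TensorProduct BigOperators

namespace Summit.BirchSwinnertonDyer.BirchSwinnertonDyer.Theorems.ErratumRoadFiveBdvCalibrationSplit

open Field
open Literature.NumberTheory.GaloisRepresentations
open Literature.NumberTheory.EllipticCurves Literature.NumberTheory.EllipticCurves.Kato2004
open Literature.NumberTheory.EllipticCurves.Kato2004.EulerSystemValues
open Literature.NumberTheory.EllipticCurves.Rank1Residual
open Literature.NumberTheory.EllipticCurves.Rank1Residual.Typed
open Literature.NumberTheory.EllipticCurves.ModularForms
open Literature.NumberTheory.EllipticCurves.Castella2018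
open Summit.BirchSwinnertonDyer.Rank1Residual
open IsDedekindDomain (HeightOneSpectrum)
open CongruenceSubgroup (Gamma0)

/-! ## §0 Vocabulary — verbatim copy of `BstwDoor.bottomClass` (bstw_door.lean l.302–305; body only, nothing asserted) -/

/-- The BOTTOM LAYER `z_ℚ ∈ H¹(ℚ, T_pE)` of a class `z₀` of a pinned Iwasawa cohomology.
[cite: Kato2004Asterisque, §12.2 (p. 220) and §14.14 (14.14.1) (p. 243)] -/
def bottomClass (W : WeierstrassCurve ℚ) [W.IsElliptic] (p : ℕ) [Fact p.Prime]
    [ContinuousSMul ℤ_[p] (W.tateModule p)] (K : ZpExtension ℚ p) {γ : absoluteGaloisGroup ℚ}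
    (I : IwasawaH1Data W p K γ) (z₀ : I.H) : H1 (tateRep W p) ⊤ :=
  layerZeroToTop W p K (I.proj 0 z₀)

/-! ## §1 The class and the explicit exponent -/

/-- The `p`-NON-EXCEPTIONAL RANK-ONE class of [BDV22, §4]: analytic rank `1`, `E[p]` irreducible, and `p` either of
non-split multiplicative reduction or of good ordinary reduction («f is not p-exceptional», [BDV22, p. 7 L16–19 and
p. 35 L24–29]).  The non-split multiplicative members with `p ≠ 2` are exactly `ClassX11b ∧ ¬ split`
(`nonExceptionalRankOneAt_of_classX11b`). [cite: BertoliniDarmonVenerucci2022, §4, p. 35] -/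
def NonExceptionalRankOneAt (W : WeierstrassCurve ℚ) [W.IsElliptic] [W.IsGloballyMinimal] (p : ℕ)
    [Fact p.Prime] : Prop :=
  W.analyticRank = 1 ∧ Irr W p ∧
    ((Mult W p ∧ ¬ W.HasSplitMultiplicativeReductionAtPrime p) ∨ GoodOrd W p)

/-- A class-X11b pair which is NON-SPLIT at `p` is `p`-non-exceptional (the multiplicative branch). -/
theorem nonExceptionalRankOneAt_of_classX11b (W : WeierstrassCurve ℚ) [W.IsElliptic] [W.IsGloballyMinimal]
    (p : ℕ) [Fact p.Prime] (hX : ClassX11b W p) (hns : ¬ W.HasSplitMultiplicativeReductionAtPrime p) :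
    NonExceptionalRankOneAt W p :=
  ⟨hX.1, hX.2.2.2, Or.inl ⟨hX.2.2.1, hns⟩⟩

/-- The EXPLICIT crossing exponent of the BDV chain (row table in the workfile docstring, `Lines/bdv_calibration_split.lean`):
`1 − ord_p(p + 1 − a_p) + ord_p c − ord_p s − ord_p k − (ord_p r_f − ord_p m_f) − v_Kato`.
Arguments: `ap = a_p(E)` (`W.LFunction p`), `c` = the Manin constant of the parametrisation (`Dt.c`), `s`, `k` =
the two Gross–Zagier descent scalars, `rf` = congruence number, `m` = (minimal) modular degree, `v` = the Kato-family
normalisation valuation `v(σ) + ord_p(λ/(q·R·∏P_ℓ))`.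
[cite: BertoliniDarmonVenerucci2022, §4 (38), p. 44] [cite: BurungaleSkinnerTianWan2024, §6.2.1 (log-Kato-elt-1), p. 60] -/
def bdvExplicitExponent (p : ℕ) (ap c : ℤ) (s : ℚ) (k : ℤ) (rf m : ℕ) (v : ℤ) : ℤ :=
  1 - padicValInt p ((p : ℤ) + 1 - ap) + padicValInt p c - padicValRat p s - padicValInt p k -
    ((padicValNat p rf : ℤ) - padicValNat p m) - v

/-- At a prime `p ≥ 5` of NON-SPLIT multiplicative reduction `a_p = −1` [KO92, Lemme 1], so `p + 1 − a_p = p + 2`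
is prime to `p` and the `a_p`-term of `bdvExplicitExponent` vanishes: the explicit exponent is the registered
`A♭-fam` exponent. [cite: KrausOesterle1992, §3 Lemme 1, p. 262] -/
theorem bdvExplicitExponent_of_not_split (W : WeierstrassCurve ℚ) [W.IsElliptic] (p : ℕ) [Fact p.Prime]
    (hm : Mult W p) (hns : ¬ W.HasSplitMultiplicativeReductionAtPrime p) (h5 : 5 ≤ p)
    (c : ℤ) (s : ℚ) (k : ℤ) (rf m : ℕ) (v : ℤ) :
    bdvExplicitExponent p (W.LFunction p) c s k rf m v =
      1 + padicValInt p c - padicValRat p s - padicValInt p k - ((padicValNat p rf : ℤ) - padicValNat p m) - v := by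
  have ha : W.LFunction p = -1 :=
    KrausOesterle1992.lFunction_apply_prime_eq_neg_one_of_not_split W p hm hns
  have h0 : padicValInt p ((p : ℤ) + 1 - W.LFunction p) = 0 := by
    rw [ha]
    refine padicValInt.eq_zero_of_not_dvd ?_
    intro hdvd
    have h2 : (p : ℤ) ∣ ((2 : ℕ) : ℤ) := by
      have h' := dvd_sub hdvd (dvd_refl (p : ℤ))
      have e : (p : ℤ) + 1 - -1 - (p : ℤ) = ((2 : ℕ) : ℤ) := by push_cast; ring
      rwa [e] at h'
    have hp2 : p ∣ 2 := Int.natCast_dvd_natCast.mp h2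
    have := Nat.le_of_dvd two_pos hp2
    omega
  rw [bdvExplicitExponent, h0]
  ring

/-! ## §2 The two pieces (the proved recomposition lives in `ErratumRoadFiveBdvCalibrationSplit`) -/

/-- **S1 — `BdvChainExplicitNonsplit`: BDV22 (38) valued up to its `(K,p)`-constant.**  There is ONE function `V`
of `(p, d_L)` such that on the whole `p`-non-exceptional rank-one class (non-split multiplicative OR good ordinary
`p ≥ 5`, `ρ̄_{E,p}` surjective), for every admissible imaginary quadratic `L` and every value-pinned data tuple of
the registered frame (binders of `BstwDoor.stub_katoBdpCrossingNonsplitFamily` from `∀ L` on, verbatim), the crossing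
norm identity holds with exponent `bdvExplicitExponent … − V p d_L`.  Content: f- and N-blindness of the one constant
of [BDV22 (38)] («depend on (K,p) but not on f», p. 44 L13–15; applied across levels in Lemma 4.6) + the valued row
ledger (module docstring; F1′, R1′, obligations c1–c6).  Why it might fail: c1 (no integral Thm 3.1 in print) and
the frozen-`β` discrepancy c3 at `p`-new weight.  Implied by `A♭-fam ∧ BstwIntegralPerrinRiouGoodOrdinary` (`V = 0`).
[cite: BertoliniDarmonVenerucci2022, §4 (38) and Lemma 4.6, p. 44–45] -/
@[conjecture]
def BdvChainExplicitNonsplit : Prop :=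
  ∃ V : ℕ → ℤ → ℤ,
    ∀ (W : WeierstrassCurve ℚ) [W.IsElliptic] [W.IsGloballyMinimal] (p : ℕ) [Fact p.Prime]
      [ContinuousSMul ℤ_[p] (W.tateModule p)] [Module.Free ℤ_[p] (W.tateModule p)]
      [Module.Finite ℤ_[p] (W.tateModule p)] [NeZero (W.conductorNorm ℤ)],
      NonExceptionalRankOneAt W p → 5 ≤ p → Surj W p →
      ∀ (L : Type) [Field L] [NumberField L], IsImaginaryQuadratic L →
        SatisfiesHeegnerHypothesis (W.conductorNorm ℤ) L → SatisfiesHeegnerHypothesis p L →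
        NumberField.discr L < -4 → Odd (NumberField.discr L) →
        (W.quadraticTwist (NumberField.discr L : ℚ)).entireLFunction 1 ≠ 0 →
      ∀ (Dt : ModularParametrizationData W (W.conductorNorm ℤ))
        (Hd : HeegnerDatum (W.conductorNorm ℤ) (NumberField.discr L)) (w₀ : NumberField.InfinitePlace L)
        (PL : (W.baseChange L).toAffine.Point),
        WeierstrassCurve.Affine.Point.map w₀.embedding.toRatAlgHom PL = heegnerPointComplex Dt Hd →
        ¬ (p : ℤ) ∣ Dt.c →
      ∀ (s : ℚ) (k : ℤ),
        (Real.sqrt ((NumberField.discr L).natAbs : ℝ) : ℂ) *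
            (W.quadraticTwist (NumberField.discr L : ℚ)).entireLFunction 1 = (s : ℂ) * (minusPeriod Dt.f : ℂ) →
        (Dt.c : ℝ) * minusPeriod Dt.f = k * W.imaginaryPeriodRat →
      ∀ (W' : WeierstrassCurve ℚ) [W'.IsElliptic] (D : ModularParametrizationData W' (W.conductorNorm ℤ)),
        D.f = Dt.f →
        (∀ (W'' : WeierstrassCurve ℚ) [W''.IsElliptic] (D'' : ModularParametrizationData W'' (W.conductorNorm ℤ)),
            D''.f = D.f → D.modularDegree ≤ D''.modularDegree) →
      ∀ (K : ZpExtension ℚ p) (hK : K.IsCyclotomic) (γ : absoluteGaloisGroup ℚ)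
        (I : IwasawaH1Data W p K γ), K.IsTopGenerator γ →
      ∀ (hp : p ≠ 2) (N : ℕ) [NeZero N] (f : CuspForm (Gamma0 N) 2), IsNewformOf W f →
      ∀ (ι : (n : ℕ) → (CyclotomicField n ℚ →+* ℂ)) (q : ℚ)
        (Λ : ∀ (m : ℕ) (r : Finset (HeightOneSpectrum (𝓞 ℚ))),
          H1 (tateRep W p) (cycSubgroup p m r) →ₗ[ℤ_[p]] ℚ_[p] ⊗[ℚ] CyclotomicField (cycLevel p m r) ℚ)
        (c d₁ a : ℤ) (A : ℕ) (d' : ℤ)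
        (z : ∀ (m : ℕ) (r : (cyclotomicLevelsRat p (badPlaces c d₁ A N)).Ideals),
          H1 (tateRep W p) ((cyclotomicLevelsRat p (badPlaces c d₁ A N)).level m r.1))
        (x : ∀ (m : ℕ) (r : (cyclotomicLevelsRat p (badPlaces c d₁ A N)).Ideals),
          CyclotomicField (cycLevel p m r.1) ℚ)
        (y : I.H) (perRatio : ℚ),
        q ≠ 0 → ZetaBody W p f ι ((q : ℚ) : ℝ) Λ c d₁ a A z x →
        (∀ n : ℕ, I.proj n y =
          levelToLayer W p hK hp (badPlaces c d₁ A N) n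
            (z (n + 1) (cyclotomicLevelsRat p (badPlaces c d₁ A N)).idealOne)) →
        0 < A → Int.gcd c (6 * p * A) = 1 → Int.gcd d₁ (6 * p * N) = 1 → (d₁ : ℤ) * d' ≡ 1 [ZMOD (A : ℤ)] →
        ratCuspFactor f true c d₁ a A d' ≠ 0 → perRatio ≠ 0 →
        plusPeriod f = ((perRatio : ℚ) : ℝ) * W.realPeriodRat →
      ∀ (ι' : PadicAlgCl p ≃+* ℂ)
        (κ : ZpExtension L p) (γ' : absoluteGaloisGroup L) (ΩK : ℂ) (Ωp : (unrIntegers p)ˣ) (Λf : UnrSeries p),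
        κ.IsAnticyclotomic → κ.IsTopGenerator γ' → ΩK ≠ 0 →
        IsBDPLFunction ι' (X11b.primeOfEmbeddingDatum p ι' w₀.embedding) κ γ' Dt.f ΩK
          ((Ωp : unrIntegers p) : ℂ_[p]) Λf →
      ∀ (X : ℂ_[p]), Λf.HasValueAt 0 X →
      ∀ σ : ℚ_[p], HasLocPKummerLog W p (bottomClass W p K I y) σ → σ ≠ 0 →
        ‖X‖ = (p : ℝ) ^ (bdvExplicitExponent p (W.LFunction p) Dt.c s k (congruenceNumber Dt.f) D.modularDegree
            (σ.valuation + padicValRat p (perRatio /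
              (q * ratCuspFactor f true c d₁ a A d' * ∏ ℓ ∈ A.primeFactors.erase p, eulerFactorAtOne W N ℓ))) -
            V p (NumberField.discr L))

/-- **S2 — `EisensteinPeriodRatioValuation L p` (the R2 atom): a CALIBRATOR exists at `(L, p)`.**  Some curve `E′`
over `ℚ` which is globally minimal, of analytic rank `1`, with `E′[p]` irreducible and `ρ̄_{E′,p}` surjective, GOOD
ORDINARY at `p`, Heegner for `L` at its conductor, with `L(E′^{d_L},1) ≠ 0`, carries a full value-pinned data tuple
of the registered frame (Heegner datum and descent scalars, minimal parametrisation in the class of `f′`, a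
value-pinned Kato family with its `IwasawaH1Data`, a BDP frame `IsBDPLFunction … Λf′` with value `X′` at the trivial
character, a Kummer logarithm `σ′ ≠ 0` of the bottom class) on which the crossing norm identity holds with exponent
`bdvExplicitExponent …` EXACTLY.  This pins BDV's `(K,p)`-constant `L(g)/log_p(u_p)` (rows 7–8 = R2; BSTW's `u_L`)
to valuation `0` in the explicit normalisation.  Finer split in §3: `CalibratorSupply L p` (conjecture-shaped) ∧
`CalibratorDataRealisable` ∧ `BstwIntegralPerrinRiouGoodOrdinary` (print-shaped) ⟹ this.  Why it might fail: supply
(no printed theorem produces `E′` for a prescribed `L`; level-aspect non-vanishing is the expected road), and the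
port's integrality at primes dividing `u_L` (BSTW (86): `u_L ∈ ℤ_(p)^×` needs their CM comparison, Thm. 6.6/6.7).
[cite: BurungaleSkinnerTianWan2024, Thm. 1.13 and §6.2.1 (86)–(94), p. 60]
[cite: BertoliniDarmonVenerucci2022, §4 (38) L13–15, p. 44] -/
@[conjecture]
def EisensteinPeriodRatioValuation (L : Type) [Field L] [NumberField L] (p : ℕ) [Fact p.Prime] : Prop :=
  ∃ (W : WeierstrassCurve ℚ) (_ : W.IsElliptic) (_ : W.IsGloballyMinimal)
    (_ : ContinuousSMul ℤ_[p] (W.tateModule p)) (_ : Module.Free ℤ_[p] (W.tateModule p))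
    (_ : Module.Finite ℤ_[p] (W.tateModule p)) (_ : NeZero (W.conductorNorm ℤ)),
    W.analyticRank = 1 ∧ Irr W p ∧ GoodOrd W p ∧ Surj W p ∧
    SatisfiesHeegnerHypothesis (W.conductorNorm ℤ) L ∧
    (W.quadraticTwist (NumberField.discr L : ℚ)).entireLFunction 1 ≠ 0 ∧
    ∃ (Dt : ModularParametrizationData W (W.conductorNorm ℤ))
      (Hd : HeegnerDatum (W.conductorNorm ℤ) (NumberField.discr L)) (w₀ : NumberField.InfinitePlace L)
      (PL : (W.baseChange L).toAffine.Point),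
      WeierstrassCurve.Affine.Point.map w₀.embedding.toRatAlgHom PL = heegnerPointComplex Dt Hd ∧
      ¬ (p : ℤ) ∣ Dt.c ∧
    ∃ (s : ℚ) (k : ℤ),
      (Real.sqrt ((NumberField.discr L).natAbs : ℝ) : ℂ) *
          (W.quadraticTwist (NumberField.discr L : ℚ)).entireLFunction 1 = (s : ℂ) * (minusPeriod Dt.f : ℂ) ∧
      (Dt.c : ℝ) * minusPeriod Dt.f = k * W.imaginaryPeriodRat ∧
    ∃ (W' : WeierstrassCurve ℚ) (_ : W'.IsElliptic) (D : ModularParametrizationData W' (W.conductorNorm ℤ)),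
      D.f = Dt.f ∧
      (∀ (W'' : WeierstrassCurve ℚ) [W''.IsElliptic] (D'' : ModularParametrizationData W'' (W.conductorNorm ℤ)),
          D''.f = D.f → D.modularDegree ≤ D''.modularDegree) ∧
    ∃ (K : ZpExtension ℚ p) (hK : K.IsCyclotomic) (γ : absoluteGaloisGroup ℚ)
      (I : IwasawaH1Data W p K γ), K.IsTopGenerator γ ∧
    ∃ (hp : p ≠ 2) (N : ℕ) (_ : NeZero N) (f : CuspForm (Gamma0 N) 2), IsNewformOf W f ∧
    ∃ (ι : (n : ℕ) → (CyclotomicField n ℚ →+* ℂ)) (q : ℚ)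
      (Λ : ∀ (m : ℕ) (r : Finset (HeightOneSpectrum (𝓞 ℚ))),
        H1 (tateRep W p) (cycSubgroup p m r) →ₗ[ℤ_[p]] ℚ_[p] ⊗[ℚ] CyclotomicField (cycLevel p m r) ℚ)
      (c d₁ a : ℤ) (A : ℕ) (d' : ℤ)
      (z : ∀ (m : ℕ) (r : (cyclotomicLevelsRat p (badPlaces c d₁ A N)).Ideals),
        H1 (tateRep W p) ((cyclotomicLevelsRat p (badPlaces c d₁ A N)).level m r.1))
      (x : ∀ (m : ℕ) (r : (cyclotomicLevelsRat p (badPlaces c d₁ A N)).Ideals),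
        CyclotomicField (cycLevel p m r.1) ℚ)
      (y : I.H) (perRatio : ℚ),
      q ≠ 0 ∧ ZetaBody W p f ι ((q : ℚ) : ℝ) Λ c d₁ a A z x ∧
      (∀ n : ℕ, I.proj n y =
        levelToLayer W p hK hp (badPlaces c d₁ A N) n
          (z (n + 1) (cyclotomicLevelsRat p (badPlaces c d₁ A N)).idealOne)) ∧
      0 < A ∧ Int.gcd c (6 * p * A) = 1 ∧ Int.gcd d₁ (6 * p * N) = 1 ∧ (d₁ : ℤ) * d' ≡ 1 [ZMOD (A : ℤ)] ∧
      ratCuspFactor f true c d₁ a A d' ≠ 0 ∧ perRatio ≠ 0 ∧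
      plusPeriod f = ((perRatio : ℚ) : ℝ) * W.realPeriodRat ∧
    ∃ (ι' : PadicAlgCl p ≃+* ℂ)
      (κ : ZpExtension L p) (γ' : absoluteGaloisGroup L) (ΩK : ℂ) (Ωp : (unrIntegers p)ˣ) (Λf : UnrSeries p),
      κ.IsAnticyclotomic ∧ κ.IsTopGenerator γ' ∧ ΩK ≠ 0 ∧
      IsBDPLFunction ι' (X11b.primeOfEmbeddingDatum p ι' w₀.embedding) κ γ' Dt.f ΩK
        ((Ωp : unrIntegers p) : ℂ_[p]) Λf ∧
    ∃ (X : ℂ_[p]), Λf.HasValueAt 0 X ∧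
    ∃ σ : ℚ_[p], HasLocPKummerLog W p (bottomClass W p K I y) σ ∧ σ ≠ 0 ∧
      ‖X‖ = (p : ℝ) ^ (bdvExplicitExponent p (W.LFunction p) Dt.c s k (congruenceNumber Dt.f) D.modularDegree
          (σ.valuation + padicValRat p (perRatio /
            (q * ratCuspFactor f true c d₁ a A d' * ∏ ℓ ∈ A.primeFactors.erase p, eulerFactorAtOne W N ℓ))))

/-! ## §4 The registered statement as a named `Prop` (the glue and the certificates live in `ErratumRoadFiveBdvCalibrationSplit`) -/

/-- The registered open stub statement `BstwDoor.stub_katoBdpCrossingNonsplitFamily` (= `A♭-fam`) as a named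
`Prop` — body = bstw_door.lean (5666110a8ff7d20b) l.782–832 verbatim (same 51 lines as the conclusion of
`katoBdpCrossingNonsplitFamily_of_bdvChain_of_calibration`; sha16 of the block `3df97ba8f0964633`).
[cite: Kato2004Asterisque, Thm. 12.5, p. 229] [cite: BurungaleSkinnerTianWan2024, Thm. 1.1, p. 3] -/
@[conjecture]
def AFlatFamStatement : Prop :=
    ∀ (W : WeierstrassCurve ℚ) [W.IsElliptic] [W.IsGloballyMinimal] (p : ℕ) [Fact p.Prime]
      [ContinuousSMul ℤ_[p] (W.tateModule p)] [Module.Free ℤ_[p] (W.tateModule p)]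
      [Module.Finite ℤ_[p] (W.tateModule p)] [NeZero (W.conductorNorm ℤ)],
      ClassX11b W p → 5 ≤ p → Surj W p → ¬ W.HasSplitMultiplicativeReductionAtPrime p →
      ∀ (L : Type) [Field L] [NumberField L], IsImaginaryQuadratic L →
        SatisfiesHeegnerHypothesis (W.conductorNorm ℤ) L → SatisfiesHeegnerHypothesis p L →
        NumberField.discr L < -4 → Odd (NumberField.discr L) →
        (W.quadraticTwist (NumberField.discr L : ℚ)).entireLFunction 1 ≠ 0 →
      ∀ (Dt : ModularParametrizationData W (W.conductorNorm ℤ))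
        (Hd : HeegnerDatum (W.conductorNorm ℤ) (NumberField.discr L)) (w₀ : NumberField.InfinitePlace L)
        (PL : (W.baseChange L).toAffine.Point),
        WeierstrassCurve.Affine.Point.map w₀.embedding.toRatAlgHom PL = heegnerPointComplex Dt Hd →
        ¬ (p : ℤ) ∣ Dt.c →
      ∀ (s : ℚ) (k : ℤ),
        (Real.sqrt ((NumberField.discr L).natAbs : ℝ) : ℂ) *
            (W.quadraticTwist (NumberField.discr L : ℚ)).entireLFunction 1 = (s : ℂ) * (minusPeriod Dt.f : ℂ) →
        (Dt.c : ℝ) * minusPeriod Dt.f = k * W.imaginaryPeriodRat →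
      ∀ (W' : WeierstrassCurve ℚ) [W'.IsElliptic] (D : ModularParametrizationData W' (W.conductorNorm ℤ)),
        D.f = Dt.f →
        (∀ (W'' : WeierstrassCurve ℚ) [W''.IsElliptic] (D'' : ModularParametrizationData W'' (W.conductorNorm ℤ)),
            D''.f = D.f → D.modularDegree ≤ D''.modularDegree) →
      ∀ (K : ZpExtension ℚ p) (hK : K.IsCyclotomic) (γ : absoluteGaloisGroup ℚ)
        (I : IwasawaH1Data W p K γ), K.IsTopGenerator γ →
      ∀ (hp : p ≠ 2) (N : ℕ) [NeZero N] (f : CuspForm (Gamma0 N) 2), IsNewformOf W f →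
      ∀ (ι : (n : ℕ) → (CyclotomicField n ℚ →+* ℂ)) (q : ℚ)
        (Λ : ∀ (m : ℕ) (r : Finset (HeightOneSpectrum (𝓞 ℚ))),
          H1 (tateRep W p) (cycSubgroup p m r) →ₗ[ℤ_[p]] ℚ_[p] ⊗[ℚ] CyclotomicField (cycLevel p m r) ℚ)
        (c d₁ a : ℤ) (A : ℕ) (d' : ℤ)
        (z : ∀ (m : ℕ) (r : (cyclotomicLevelsRat p (badPlaces c d₁ A N)).Ideals),
          H1 (tateRep W p) ((cyclotomicLevelsRat p (badPlaces c d₁ A N)).level m r.1))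
        (x : ∀ (m : ℕ) (r : (cyclotomicLevelsRat p (badPlaces c d₁ A N)).Ideals),
          CyclotomicField (cycLevel p m r.1) ℚ)
        (y : I.H) (perRatio : ℚ),
        q ≠ 0 → ZetaBody W p f ι ((q : ℚ) : ℝ) Λ c d₁ a A z x →
        (∀ n : ℕ, I.proj n y =
          levelToLayer W p hK hp (badPlaces c d₁ A N) n
            (z (n + 1) (cyclotomicLevelsRat p (badPlaces c d₁ A N)).idealOne)) →
        0 < A → Int.gcd c (6 * p * A) = 1 → Int.gcd d₁ (6 * p * N) = 1 → (d₁ : ℤ) * d' ≡ 1 [ZMOD (A : ℤ)] →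
        ratCuspFactor f true c d₁ a A d' ≠ 0 → perRatio ≠ 0 →
        plusPeriod f = ((perRatio : ℚ) : ℝ) * W.realPeriodRat →
      ∀ (ι' : PadicAlgCl p ≃+* ℂ)
        (κ : ZpExtension L p) (γ' : absoluteGaloisGroup L) (ΩK : ℂ) (Ωp : (unrIntegers p)ˣ) (Λf : UnrSeries p),
        κ.IsAnticyclotomic → κ.IsTopGenerator γ' → ΩK ≠ 0 →
        IsBDPLFunction ι' (X11b.primeOfEmbeddingDatum p ι' w₀.embedding) κ γ' Dt.f ΩK
          ((Ωp : unrIntegers p) : ℂ_[p]) Λf →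
      ∀ (X : ℂ_[p]), Λf.HasValueAt 0 X →
      ∀ σ : ℚ_[p], HasLocPKummerLog W p (bottomClass W p K I y) σ → σ ≠ 0 →
        ‖X‖ = (p : ℝ) ^ (1 + padicValInt p Dt.c - padicValRat p s - padicValInt p k -
            ((padicValNat p (congruenceNumber Dt.f) : ℤ) - padicValNat p D.modularDegree) -
            (σ.valuation + padicValRat p (perRatio /
              (q * ratCuspFactor f true c d₁ a A d' * ∏ ℓ ∈ A.primeFactors.erase p, eulerFactorAtOne W N ℓ))))

end Summit.BirchSwinnertonDyer.BirchSwinnertonDyer.Theorems.ErratumRoadFiveBdvCalibrationSplit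

end
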